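import Summits.AtomisticToContinuum.HydrodynamicLimit.Theses.AntiMazurCoboundaries
import Literature.MathematicalPhysics.KineticTheory.HardSphereEulerProofs
import Summits.AtomisticToContinuum.HydrodynamicLimit.Theorems.PolynomialCompression.Negative.PdeForm

/-!
# Negative knowledge for `KineticWindowGronwall` (stmt-AtomisticToContinuum-9282), IV: the consequent's static shadow

From the standing disprover's `Cruxes/KineticWindowGronwall/Disproof.lean` §9 (cycle 2,
refuter-cdisprove-stmt-AtomisticToContinuum-9282-g2-0). `RelEntropyVanishing` with its entropy clause deleted is the
purely static statement `DensityRepresentable` (every classical hard-sphere-Euler solution tied to local Gibbs data has,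
at every `t < T`, fields that are exponential-LLN limits of SOME local Gibbs law at the same `σ`);
`relEntropyVanishing_imp_representable : RelEntropyVanishing → DensityRepresentable`, hence given the antecedent the crux
implies it (`crux_imp_representable_of_antecedent`). Contrapositive: a non-representable density along a classical
solution from tied dilute data (a dense excursion, crux `ImplosionDichotomy.DenseExcursion`, stmt-12586) refutes the
target and, modulo the antecedent, the crux. Pure theorems; no positive Theses conclusion.
-/

noncomputable section

namespace Summit.AtomisticToContinuum.HydrodynamicLimit.Theorems.KineticWindowGronwallNegative

open MeasureTheory Filter Set Topology
open scoped ENNReal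
open Literature.MathematicalPhysics.KineticTheory Literature.Analysis.FluidPDE
open Summit.AtomisticToContinuum.HydrodynamicLimit.Theses.AntiMazurCoboundaries
open Summit.AtomisticToContinuum.HydrodynamicLimit.Theorems.PolynomialCompressionPDE (Flows)

/-- Clauses (i)–(ii) of the consequent's conclusion at the times `t ∈ [0,T)`: SOME activity profile `a` makes
`localGibbsLaw σ a (u t) (θ t)` a probability measure whose three empirical fields concentrate exponentially around
`(ρ_t, ρ_t u_t, E_t)` — the entropy clause (iii) deleted. Purely STATIC in `(ρ_t, u_t, θ_t)`. -/
def RepresentableAt (σ T : ℝ) (ρ θ : ℝ → T3 → ℝ) (u : ℝ → T3 → V3) (Φ : Flows σ) : Prop :=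
  ∀ t ∈ Set.Ico 0 T, ∃ a : T3 → ℝ,
    (∀ N, IsProbabilityMeasure (localGibbsLaw σ a (u t) (θ t) N (Φ N))) ∧
    (∀ χ : T3 → ℝ, Continuous χ → ∀ δ : ℝ, 0 < δ → ∃ C : ℝ, 0 < C ∧ ∀ N : ℕ,
      localGibbsLaw σ a (u t) (θ t) N (Φ N)
          {z | δ < |empiricalDensityField z χ - ∫ x, χ x * ρ t x|} ≤
        ENNReal.ofReal (C * Real.exp (-(C⁻¹ * (N + 1)))) ∧
      localGibbsLaw σ a (u t) (θ t) N (Φ N)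
          {z | δ < ‖empiricalMomentumField z χ - ∫ x, (χ x * ρ t x) • u t x‖} ≤
        ENNReal.ofReal (C * Real.exp (-(C⁻¹ * (N + 1)))) ∧
      localGibbsLaw σ a (u t) (θ t) N (Φ N)
          {z | δ < |empiricalEnergyField z χ -
            ∫ x, χ x * totalEnergyDensity (ρ t x) (u t x) (θ t x)|} ≤
        ENNReal.ofReal (C * Real.exp (-(C⁻¹ * (N + 1)))))

/-- **Density representability** — `RelEntropyVanishing` with its entropy clause deleted: for all profiles,
`∃ σ₀ ∀ σ < σ₀`, for EVERY classical hard-sphere-Euler solution tied to the local Gibbs data at `t = 0` and every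
`t < T`, the Euler fields `(ρ_t, u_t, θ_t)` are the exponential-LLN limits of some local Gibbs law at reduced density
`σ`. A statement of equilibrium statistical mechanics along the solution; no dynamics of spheres. -/
def DensityRepresentable : Prop :=
  ∀ (a₀ θ₀ : T3 → ℝ) (u₀ : T3 → V3), Continuous a₀ → Continuous θ₀ → Continuous u₀ → (∀ x, 0 < a₀ x) →
    (∀ x, 0 < θ₀ x) → ∃ σ₀ : ℝ, 0 < σ₀ ∧ ∀ σ : ℝ, 0 < σ → σ < σ₀ →
    ∀ (T : ℝ) (ρ θ : ℝ → T3 → ℝ) (u : ℝ → T3 → V3), IsHardSphereEulerSolution σ T ρ u θ →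
    ∀ Φ : Flows σ, TendstoHydroFieldsAt (fun N => localGibbsLaw σ a₀ u₀ θ₀ N (Φ N)) Φ ρ u θ 0 →
      RepresentableAt σ T ρ θ u Φ

/-- **B carries a static obligation that A does not mention**: `RelEntropyVanishing → DensityRepresentable`.
Contrapositive use (the only door to `¬B` this seat can see): a classical solution from tied DILUTE data whose
density at some `t < T` is NOT representable at reduced density `σ` — e.g. a dense excursion `ρ_t σ³ ≳ η_freezing`
somewhere, where no fluid local Gibbs state reproduces a smooth profile — would refute B for that `σ`, and B fixes
`σ₀(a₀,θ₀,u₀)` BEFORE the solution (hence before its horizon `T` and its compression) is quantified. Whether such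
solutions exist from smooth dilute tied data is exactly crux `ImplosionDichotomy.DenseExcursion` (stmt-12586; its
standing disprover records RESISTS, with the EOS-free compression budget `ρ_t ≤ max ρ₀ · e^{Kt}` under `div u ≥ −K`,
`Theorems/DenseExcursion/Negative/CompressionBudget.lean`): in the bounded-compression class the reduced density
along the solution stays `≤ σ (max ρ₀)^{1/3} e^{Kt/3}` and the door is shut. The antecedent speaks of density `1` only (`KineticWindowGronwallNegative.kineticFluxLdDecay_iff_unitActivity`). [folklore] -/
theorem relEntropyVanishing_imp_representable : RelEntropyVanishing → DensityRepresentable := by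
  intro h a₀ θ₀ u₀ ha hθ hu ha0 hθ0
  obtain ⟨σ₀, hσ₀, H⟩ := h a₀ θ₀ u₀ ha hθ hu ha0 hθ0
  refine ⟨σ₀, hσ₀, fun σ hσ hσ' T ρ θ u hE Φ htie t ht => ?_⟩
  obtain ⟨-, H2⟩ := H σ hσ hσ' T ρ θ u hE Φ
  obtain ⟨a, hPa, hconc, -⟩ := H2 htie t ht
  exact ⟨a, hPa, hconc⟩

/-- Hence, given the antecedent, the crux implies the static representability statement: any refutation of
`DensityRepresentable` is a refutation of the crux modulo A (and of the target 0766 outright). [folklore] -/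
theorem crux_imp_representable_of_antecedent (hA : KineticFluxLdDecay) (h : KineticWindowGronwall) :
    DensityRepresentable :=
  relEntropyVanishing_imp_representable (h hA)

end Summit.AtomisticToContinuum.HydrodynamicLimit.Theorems.KineticWindowGronwallNegative

end
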